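import Literature.NumberTheory.EllipticCurves.TowerSaturatedCartesianProofs
import HarnessLib

/-!
# Saturated level conditions are exact orthogonal complements when the limit conditions are
# (the abstract core of Howard's H.4 for `F_𝔮`: isotropy and exactness DESCEND from the limit)

`Proofs` file (theorems only; no definition, no named fact, no instance, no `sorry`), in the currency of
the tree's abstract towers `Literature.NumberTheory.EllipticCurves.Tower.*` (`compatibleFamilies`,
`saturatedFamilies`, `levelCondition`; file `ZpExtensionEisensteinSelmerStructure.lean`), companion of
`TowerSaturatedCartesianProofs.lean` (H.3).

Howard 2004, Hypothesis H.4 asks that at every finite place `v` the local condition `F_v ⊂ H¹(K_v, T)` be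
«its own exact orthogonal complement under the induced local pairing `H¹(K_v, T) × H¹(K_v̄, T) → R`»
(arXiv:1202.6340 p. 7, L78–82; typed in the tree as the two `↔` clauses of
`Howard2004.DualityDatum.IsSelfOrthogonalAt`).  For the specialised structure `F_𝔮` on the levels
`T_𝔮/p^k` Howard obtains this from «the local conditions `F_Λ` on `𝐓` and `𝐀` are everywhere exact
orthogonal complements under the local Tate pairing» (Def. 2.2.6 ff., p. 16) by propagation from the
compact module, i.e. from SATURATION: at a finite level the strict images (e.g. `im H¹(K_v, Fil W_k)`) are
isotropic but in general NOT exact annihilators (finite error terms `H⁰(K_v, gr W_k)`, `H²(K_v, Fil W_k)`),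
whereas the saturated conditions `Tower.levelCondition red p C k` — the level-`k` components of the
`p`-saturated compatible families — are.  This file proves that descent ABSTRACTLY, for two towers
`(X_j, red)`, `(Y_j, red′)` of abelian groups with cores `C_j ≤ X_j`, `C′_j ≤ Y_j` and bi-additive level
pairings `B_j : X_j × Y_j → Q_j` (cell `pub/bsd-print-x9`, memo `HOME/p1/H4-AT-P-PLAN` steps (A2)/(A3)
«LIMIT FORM … then project to level `k`»):

* §1 the TORSION compatible families are saturated for every core: the bottom condition
  `levelCondition red p (fun _ ↦ ⊥) k` (images of torsion classes of the limit — for `H¹(K_v, T)` the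
  Kummer image of `H⁰(K_v, A)`) lies in every `levelCondition red p C k`;
* §2 ISOTROPY DESCENDS (`pairing_eq_zero_of_mem_levelCondition`): if the level pairings are compatible
  with the reductions into a value tower `(Q_j, redQ)` whose limit is torsion-free in the levelwise form
  «`p • q = 0 → redQ q = 0`» (e.g. `Q_j = ℤ/p^j`, `A_{m,j}`), and the CORES are isotropic at every level,
  then the saturated level conditions are isotropic at every level (the limit value of a pair of
  saturated families is killed by a power of `p`, hence zero);
* §3 EXACTNESS DESCENDS (`mem_levelCondition_of_forall_pairing_eq_zero`): a class `y ∈ Y_k` orthogonal to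
  `levelCondition red p C k` lies in `levelCondition red′ p C′ k`, from three inputs the instantiator
  supplies: (Dual) a class orthogonal to the BOTTOM condition of `X` lies in the TOP condition of `Y`
  (is liftable to a compatible family) — finite-level Tate duality + the Kummer description of the
  annihilator of the liftable classes; (Exact) the LIMIT statement «a compatible family `η` of `Y` whose
  level-`k` component is orthogonal to the components of all saturated families of `X` is `n • η′` plus a
  saturated family of `Y`» — exact orthogonal complements in the limit together with the saturation of
  the dual quotient (module theory over the DVR, file `Literature/Algebra/Module/…`, and the
  Euler-characteristic rank count); (T) `n • Y_k = 0`;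
* §4 both `↔` clauses in the shape of `DualityDatum.IsSelfOrthogonalAt`
  (`levelCondition_mem_iff_forall_pairing_eq_zero`).

Nothing arithmetic is proved here; no summit statement is proved; BSD is not proved by any of this.

References: B. Howard, *The Heegner point Kolyvagin system*, Compositio Math. 140 (2004), H.4 and
Lemma 3.1.1 / Def. 3.2.6 (arXiv:1202.6340 p. 7 L69–82, p. 15, p. 16); B. Mazur, K. Rubin, *Kolyvagin
systems*, Mem. AMS 799 (2004), §1.3 (local duality, exact orthogonal complements) and Lemma 3.7.1;
J. S. Milne, *Arithmetic Duality Theorems* (2006), I Cor. 2.3 / Thm. 2.6; J.-P. Serre, *Galois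
Cohomology* (1997), I §2.2 (limits of finite modules).
-/

noncomputable section

universe u v w

namespace Literature.NumberTheory.EllipticCurves

namespace Tower

variable {X : ℕ → Type u} [∀ j, AddCommGroup (X j)] (red : ∀ j, X (j + 1) →+ X j)
variable {Y : ℕ → Type v} [∀ j, AddCommGroup (Y j)] (red' : ∀ j, Y (j + 1) →+ Y j)

/-! ## §1 Torsion compatible families are saturated; the bottom condition lies in every condition -/

/-- A compatible family killed by a power of `p` is saturated for EVERY family of cores (`p^b • x_j = 0
∈ C_j`): the torsion of the limit `lim_j H_j` lies in every propagated condition — for `H¹(K_v, T)` these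
are the Kummer classes from `H⁰(K_v, A)`. [cite: Howard2004HeegnerKolyvagin, Def. 1.1.1 and Def. 3.1.2 (arXiv Def. 2.1.1, p. 5: propagation from V; p. 15)]
[cite: MazurRubinMemoirs2004, Lemma 3.7.1] -/
theorem mem_saturatedFamilies_of_nsmul_eq_zero (p : ℕ) (C : ∀ j, AddSubgroup (X j)) {x : Π j, X j}
    (hx : x ∈ compatibleFamilies red) {b : ℕ} (hb : p ^ b • x = 0) :
    x ∈ saturatedFamilies red p C := by
  refine (mem_saturatedFamilies_iff red p C x).2 ⟨(mem_compatibleFamilies_iff red x).1 hx, b, fun j ↦ ?_⟩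
  have hj := congrFun hb j
  rw [Pi.smul_apply, Pi.zero_apply] at hj
  rw [hj]
  exact zero_mem _

/-- The saturated families for the ZERO cores are exactly the compatible families killed by a power of `p`
(the torsion of the limit). [cite: Howard2004HeegnerKolyvagin, Def. 1.1.1 (arXiv Def. 2.1.1, p. 5)] -/
theorem mem_saturatedFamilies_bot_iff (p : ℕ) (x : Π j, X j) :
    x ∈ saturatedFamilies red p (fun _ ↦ (⊥ : AddSubgroup (X _))) ↔
      x ∈ compatibleFamilies red ∧ ∃ b : ℕ, p ^ b • x = 0 := by
  rw [mem_saturatedFamilies_iff, mem_compatibleFamilies_iff]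
  refine and_congr_right fun _ ↦ exists_congr fun b ↦ ?_
  constructor
  · intro h
    funext j
    rw [Pi.smul_apply, Pi.zero_apply]
    exact (AddSubgroup.mem_bot).1 (h j)
  · intro h j
    have hj := congrFun h j
    rw [Pi.smul_apply, Pi.zero_apply] at hj
    rw [hj]
    exact zero_mem _

/-- Membership in the BOTTOM level condition `levelCondition red p ⊥ k`: the level-`k` components of the
torsion compatible families. [cite: Howard2004HeegnerKolyvagin, Def. 1.1.1 and Def. 1.1.3 (arXiv p. 5)] -/
theorem mem_levelCondition_bot_iff (p : ℕ) (k : ℕ) (y : X k) :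
    y ∈ levelCondition red p (fun _ ↦ (⊥ : AddSubgroup (X _))) k ↔
      ∃ x ∈ compatibleFamilies red, (∃ b : ℕ, p ^ b • x = 0) ∧ x k = y := by
  rw [mem_levelCondition_iff]
  constructor
  · rintro ⟨x, hx, rfl⟩
    obtain ⟨hxc, hb⟩ := (mem_saturatedFamilies_bot_iff red p x).1 hx
    exact ⟨x, hxc, hb, rfl⟩
  · rintro ⟨x, hxc, hb, rfl⟩
    exact ⟨x, (mem_saturatedFamilies_bot_iff red p x).2 ⟨hxc, hb⟩, rfl⟩

/-- **The bottom condition lies in every level condition**: the images of the torsion classes of the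
limit belong to every propagated condition (`⊥ ≤ C_j`). [cite: Howard2004HeegnerKolyvagin, Def. 1.1.10 (arXiv Def. 2.1.10, p. 6: the partial order on Selmer structures)]
[cite: MazurRubinMemoirs2004, Lemma 3.7.1] -/
theorem levelCondition_bot_le (p : ℕ) (C : ∀ j, AddSubgroup (X j)) (k : ℕ) :
    levelCondition red p (fun _ ↦ (⊥ : AddSubgroup (X _))) k ≤ levelCondition red p C k :=
  levelCondition_mono red p (fun _ ↦ bot_le) k

/-- The level-`k` component of a compatible family killed by a power of `p` lies in every level condition.
[cite: Howard2004HeegnerKolyvagin, Def. 1.1.1 and Def. 3.1.2 (arXiv pp. 5, 15)] -/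
theorem apply_mem_levelCondition_of_nsmul_eq_zero (p : ℕ) (C : ∀ j, AddSubgroup (X j)) {x : Π j, X j}
    (hx : x ∈ compatibleFamilies red) {b : ℕ} (hb : p ^ b • x = 0) (k : ℕ) :
    x k ∈ levelCondition red p C k :=
  apply_mem_levelCondition red p C (mem_saturatedFamilies_of_nsmul_eq_zero red p C hx hb) k

/-! ## §2 Isotropy descends from the cores to the saturated level conditions -/

section Isotropy

variable {Q : ℕ → Type w} [∀ j, AddCommGroup (Q j)] (redQ : ∀ j, Q (j + 1) →+ Q j)
  (B : ∀ j, X j →+ Y j →+ Q j)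

/-- For reduction-compatible level pairings, the values `(B_j (x_j, y_j))_j` of two compatible families
form a compatible family of the value tower (the limit pairing `lim X_j × lim Y_j → lim Q_j`).
[cite: SerreGaloisCohomology1997, Ch. I §2.2 (inverse limits)] [cite: Howard2004HeegnerKolyvagin, H.4 (arXiv p. 7, L78–82: the induced local pairing)] -/
theorem pairing_mem_compatibleFamilies
    (hB : ∀ j (x : X (j + 1)) (y : Y (j + 1)), redQ j (B (j + 1) x y) = B j (red j x) (red' j y))
    {x : Π j, X j} (hx : x ∈ compatibleFamilies red) {y : Π j, Y j} (hy : y ∈ compatibleFamilies red') :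
    (fun j ↦ B j (x j) (y j)) ∈ compatibleFamilies redQ := by
  rw [mem_compatibleFamilies_iff]
  intro j
  rw [hB, (mem_compatibleFamilies_iff red x).1 hx j, (mem_compatibleFamilies_iff red' y).1 hy j]

/-- **The limit of the value tower has no `p`-torsion** when levelwise «`p • q = 0 → redQ q = 0`» (true for
`Q_j = ℤ/p^j`, for `A_{m,j} = S_m/p^j` over the DVR `S_m`, …): a compatible family killed by `p` is zero.
[cite: SerreGaloisCohomology1997, Ch. I §2.2] -/
theorem eq_zero_of_smul_eq_zero_of_mem_compatibleFamilies (p : ℕ)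
    (hQ : ∀ j (q : Q (j + 1)), p • q = 0 → redQ j q = 0) {q : Π j, Q j}
    (hq : q ∈ compatibleFamilies redQ) (hpq : p • q = 0) : q = 0 := by
  funext j
  rw [Pi.zero_apply, ← (mem_compatibleFamilies_iff redQ q).1 hq j]
  apply hQ
  have h := congrFun hpq (j + 1)
  rwa [Pi.smul_apply, Pi.zero_apply] at h

/-- The same for any power of `p`: a compatible family of the value tower killed by `p^c` is zero.
[cite: SerreGaloisCohomology1997, Ch. I §2.2] -/
theorem eq_zero_of_pow_smul_eq_zero_of_mem_compatibleFamilies (p : ℕ)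
    (hQ : ∀ j (q : Q (j + 1)), p • q = 0 → redQ j q = 0) {q : Π j, Q j}
    (hq : q ∈ compatibleFamilies redQ) {c : ℕ} (hpq : p ^ c • q = 0) : q = 0 := by
  induction c generalizing q with
  | zero => simpa using hpq
  | succ c ih =>
    have hpc : p ^ c • q ∈ compatibleFamilies redQ := AddSubgroup.nsmul_mem _ hq _
    have hzero : p ^ c • q = 0 :=
      eq_zero_of_smul_eq_zero_of_mem_compatibleFamilies redQ p hQ hpc (by
        rw [← mul_smul, ← pow_succ', hpq])
    exact ih hq hzero

/-- **Isotropy descends**: if the level pairings are reduction-compatible into a value tower with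
torsion-free limit and the CORES are isotropic at every level (`B_j (C_j, C′_j) = 0` — e.g. the images of
`H¹(K_v, Fil W_j)` at `v` and at `v̄`, by the vanishing of the Weil pairing on `Fil × Fil`), then the
SATURATED level conditions are isotropic at every level: for saturated `ξ`, `η` the limit value
`(B_j (ξ_j, η_j))_j` is killed by `p^{a+b}`, hence is zero.
[cite: Howard2004HeegnerKolyvagin, H.4 and Lemma 3.1.1 / Def. 3.2.6 (arXiv p. 7 L78–82, p. 15, p. 16)]
[cite: MazurRubinMemoirs2004, §1.3] -/
theorem pairing_eq_zero_of_mem_levelCondition (p : ℕ) (C : ∀ j, AddSubgroup (X j))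
    (C' : ∀ j, AddSubgroup (Y j))
    (hB : ∀ j (x : X (j + 1)) (y : Y (j + 1)), redQ j (B (j + 1) x y) = B j (red j x) (red' j y))
    (hQ : ∀ j (q : Q (j + 1)), p • q = 0 → redQ j q = 0)
    (hC : ∀ j, ∀ c ∈ C j, ∀ c' ∈ C' j, B j c c' = 0)
    (k : ℕ) {x : X k} (hx : x ∈ levelCondition red p C k) {y : Y k}
    (hy : y ∈ levelCondition red' p C' k) : B k x y = 0 := by
  obtain ⟨ξ, hξ, rfl⟩ := (mem_levelCondition_iff red p C k x).1 hx
  obtain ⟨η, hη, rfl⟩ := (mem_levelCondition_iff red' p C' k y).1 hy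
  obtain ⟨hξc, a, ha⟩ := (mem_saturatedFamilies_iff red p C ξ).1 hξ
  obtain ⟨hηc, b, hb⟩ := (mem_saturatedFamilies_iff red' p C' η).1 hη
  have hq : (fun j ↦ B j (ξ j) (η j)) ∈ compatibleFamilies redQ :=
    pairing_mem_compatibleFamilies red red' redQ B hB
      ((mem_compatibleFamilies_iff red ξ).2 hξc) ((mem_compatibleFamilies_iff red' η).2 hηc)
  have hkill : p ^ (a + b) • (fun j ↦ B j (ξ j) (η j)) = 0 := by
    funext j
    rw [Pi.smul_apply, Pi.zero_apply, pow_add, mul_smul, ← map_nsmul,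
      ← AddMonoidHom.nsmul_apply, ← map_nsmul]
    exact hC j _ (ha j) _ (hb j)
  have h0 := eq_zero_of_pow_smul_eq_zero_of_mem_compatibleFamilies redQ p hQ hq hkill
  exact congrFun h0 k

end Isotropy

/-! ## §3 Exactness descends from the limit to the saturated level conditions -/

section Exactness

variable {Qk : Type w} [AddCommGroup Qk]

/-- **Exactness descends** (one level `k`, one bi-additive pairing `B : X_k × Y_k → Q`). Suppose
(Dual) every `y ∈ Y_k` orthogonal to the BOTTOM condition of `X` (the components of the torsion
compatible families) lies in the TOP condition of `Y` (is the component of a compatible family) — at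
`H¹(K_v, T/p^k)` this is finite-level Tate duality together with the Kummer description
`(im H¹(K_v̄, T) → H¹(K_v̄, T/p^k))^⊥ = im (H⁰(K_v, A) → H¹(K_v, T/p^k)) = image of H¹(K_v, T)_tors`;
(Exact) the LIMIT statement: a compatible family `η` of `Y` with `B (ξ_k, η_k) = 0` for all saturated `ξ`
differs from an `n`-th multiple by a saturated family of `Y`; (T) `n • Y_k = 0`.  Then every `y ∈ Y_k`
orthogonal to `levelCondition red p C k` lies in `levelCondition red′ p C′ k`.
[cite: Howard2004HeegnerKolyvagin, H.4 and Def. 3.2.6 (arXiv p. 7 L78–82; p. 16: exact orthogonal complements, propagated)]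
[cite: MazurRubinMemoirs2004, §1.3 and Lemma 3.7.1] [cite: MilneADT2006, Ch. I Cor. 2.3 and Thm. 2.6] -/
theorem mem_levelCondition_of_forall_pairing_eq_zero (p : ℕ) (C : ∀ j, AddSubgroup (X j))
    (C' : ∀ j, AddSubgroup (Y j)) (k : ℕ) (B : X k →+ Y k →+ Qk) (n : ℕ)
    (hT : ∀ y : Y k, n • y = 0)
    (hDual : ∀ y : Y k, (∀ x ∈ levelCondition red p (fun _ ↦ (⊥ : AddSubgroup (X _))) k, B x y = 0) →
      y ∈ levelCondition red' p (fun _ ↦ (⊤ : AddSubgroup (Y _))) k)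
    (hExact : ∀ η ∈ compatibleFamilies red', (∀ ξ ∈ saturatedFamilies red p C, B (ξ k) (η k) = 0) →
      ∃ η' : Π j, Y j, η - n • η' ∈ saturatedFamilies red' p C')
    (y : Y k) (hy : ∀ x ∈ levelCondition red p C k, B x y = 0) :
    y ∈ levelCondition red' p C' k := by
  -- (Dual): `y` lifts to a compatible family `η`
  have hlift : y ∈ levelCondition red' p (fun _ ↦ (⊤ : AddSubgroup (Y _))) k :=
    hDual y fun x hx ↦ hy x (levelCondition_bot_le red p C k hx)
  obtain ⟨η, hη, rfl⟩ := (mem_levelCondition_top_iff red' p k y).1 hlift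
  -- (Exact): `η = n • η' + σ` with `σ` saturated
  obtain ⟨η', hσ⟩ := hExact η hη fun ξ hξ ↦ hy (ξ k) (apply_mem_levelCondition red p C hξ k)
  -- (T): `η_k = σ_k`
  have hk : η k = (η - n • η') k := by
    rw [Pi.sub_apply, Pi.smul_apply, hT, sub_zero]
  rw [hk]
  exact apply_mem_levelCondition red' p C' hσ k

/-- The annihilator form of §3: under (Dual), (Exact), (T) the (right) annihilator
`⨅ x ∈ levelCondition red p C k, ker B(x, ·)` of the level condition of `X` is contained in the level
condition of `Y`. [cite: Howard2004HeegnerKolyvagin, H.4 (arXiv p. 7, L78–82)] [cite: MilneADT2006, Ch. I §0 Prop. 0.19 and Cor. 2.3] -/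
theorem iInf_ker_levelCondition_le (p : ℕ) (C : ∀ j, AddSubgroup (X j))
    (C' : ∀ j, AddSubgroup (Y j)) (k : ℕ) (B : X k →+ Y k →+ Qk) (n : ℕ)
    (hT : ∀ y : Y k, n • y = 0)
    (hDual : ∀ y : Y k, (∀ x ∈ levelCondition red p (fun _ ↦ (⊥ : AddSubgroup (X _))) k, B x y = 0) →
      y ∈ levelCondition red' p (fun _ ↦ (⊤ : AddSubgroup (Y _))) k)
    (hExact : ∀ η ∈ compatibleFamilies red', (∀ ξ ∈ saturatedFamilies red p C, B (ξ k) (η k) = 0) →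
      ∃ η' : Π j, Y j, η - n • η' ∈ saturatedFamilies red' p C') :
    (⨅ x ∈ levelCondition red p C k, (B x).ker : AddSubgroup (Y k)) ≤ levelCondition red' p C' k := by
  intro y hy
  simp only [AddSubgroup.mem_iInf, AddMonoidHom.mem_ker] at hy
  exact mem_levelCondition_of_forall_pairing_eq_zero red red' p C C' k B n hT hDual hExact y hy

end Exactness

/-! ## §4 Both clauses of «the level conditions are exact orthogonal complements of each other» -/

section SelfOrthogonal

variable {Q : ℕ → Type w} [∀ j, AddCommGroup (Q j)] (redQ : ∀ j, Q (j + 1) →+ Q j)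
  (B : ∀ j, X j →+ Y j →+ Q j)

/-- **Saturated level conditions are exact orthogonal complements of each other** — the two `↔` clauses
of `Howard2004.DualityDatum.IsSelfOrthogonalAt`, abstractly, at a level `k`: from reduction-compatible
level pairings into a value tower with torsion-free limit, levelwise isotropic cores (§2), and, on both
sides, the duality input (Dual), the limit exactness (Exact) and the exponent bound (T) of §3 (the `X`-side
inputs stated for the flipped pairing `B_k.flip : Y_k × X_k → Q_k`).
[cite: Howard2004HeegnerKolyvagin, H.4 and Lemma 3.1.1 / Def. 3.2.6 (arXiv p. 7 L78–82, p. 15, p. 16)]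
[cite: MazurRubinMemoirs2004, §1.3 and Lemma 3.7.1] [cite: MilneADT2006, Ch. I Cor. 2.3 and Thm. 2.6] -/
theorem levelCondition_mem_iff_forall_pairing_eq_zero (p : ℕ) (C : ∀ j, AddSubgroup (X j))
    (C' : ∀ j, AddSubgroup (Y j))
    (hB : ∀ j (x : X (j + 1)) (y : Y (j + 1)), redQ j (B (j + 1) x y) = B j (red j x) (red' j y))
    (hQ : ∀ j (q : Q (j + 1)), p • q = 0 → redQ j q = 0)
    (hC : ∀ j, ∀ c ∈ C j, ∀ c' ∈ C' j, B j c c' = 0)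
    (k : ℕ) (n : ℕ) (hTX : ∀ x : X k, n • x = 0) (hTY : ∀ y : Y k, n • y = 0)
    (hDualY : ∀ y : Y k, (∀ x ∈ levelCondition red p (fun _ ↦ (⊥ : AddSubgroup (X _))) k, B k x y = 0) →
      y ∈ levelCondition red' p (fun _ ↦ (⊤ : AddSubgroup (Y _))) k)
    (hDualX : ∀ x : X k, (∀ y ∈ levelCondition red' p (fun _ ↦ (⊥ : AddSubgroup (Y _))) k, B k x y = 0) →
      x ∈ levelCondition red p (fun _ ↦ (⊤ : AddSubgroup (X _))) k)
    (hExactY : ∀ η ∈ compatibleFamilies red', (∀ ξ ∈ saturatedFamilies red p C, B k (ξ k) (η k) = 0) →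
      ∃ η' : Π j, Y j, η - n • η' ∈ saturatedFamilies red' p C')
    (hExactX : ∀ ξ ∈ compatibleFamilies red, (∀ η ∈ saturatedFamilies red' p C', B k (ξ k) (η k) = 0) →
      ∃ ξ' : Π j, X j, ξ - n • ξ' ∈ saturatedFamilies red p C) :
    (∀ x : X k, x ∈ levelCondition red p C k ↔
        ∀ y ∈ levelCondition red' p C' k, B k x y = 0) ∧
      ∀ y : Y k, y ∈ levelCondition red' p C' k ↔
        ∀ x ∈ levelCondition red p C k, B k x y = 0 := by
  refine ⟨fun x ↦ ⟨fun hx y hy ↦ ?_, fun hx ↦ ?_⟩, fun y ↦ ⟨fun hy x hx ↦ ?_, fun hy ↦ ?_⟩⟩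
  · exact pairing_eq_zero_of_mem_levelCondition red red' redQ B p C C' hB hQ hC k hx hy
  · -- exactness on the `X`-side: §3 for the flipped pairing and the swapped towers
    refine mem_levelCondition_of_forall_pairing_eq_zero red' red p C' C k (B k).flip n hTX
      (fun x' hx' ↦ hDualX x' fun y hy ↦ ?_) (fun ξ hξ hξ0 ↦ hExactX ξ hξ fun η hη ↦ ?_) x ?_
    · simpa only [AddMonoidHom.flip_apply] using hx' y hy
    · simpa only [AddMonoidHom.flip_apply] using hξ0 η hη
    · intro y hy
      rw [AddMonoidHom.flip_apply]
      exact hx y hy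
  · exact pairing_eq_zero_of_mem_levelCondition red red' redQ B p C C' hB hQ hC k hx hy
  · exact mem_levelCondition_of_forall_pairing_eq_zero red red' p C C' k (B k) n hTY hDualY hExactY y hy

end SelfOrthogonal

end Tower

end Literature.NumberTheory.EllipticCurves

end
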